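import Mathlib
import Literature.Computability.AlgebraicComplexity.MatrixMultiplicationExponent
import Summits.MatrixMultiplication.MatrixMultiplication.Theses.ProbeRankThreshold
import Summits.MatrixMultiplication.MatrixMultiplication.Theorems.ProbeRankThresholdFixedRankSaturationDecomp

/-!
# `FixedRankSaturation` (route ProbeRankThreshold, item stmt-MatrixMultiplication-6606)

FIXED-ENTANGLEMENT SATURATION: for every `k` and `ε > 0`, for all large `n`, `⟨n,n,n⟩` has a
decomposition into at most `(1+ε) n³/2^k` triads all of whose probes (legs read as `n × n`
matrices) have rank `≤ 2^k` — so, with the X-rank law `R_ρ(n) ≥ n³/ρ`, the fixed-probe-rank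
filtration is exactly `R_ρ(n) = (1+o(1)) n³/ρ` along `ρ = 2^k`.

Proof (this file, on top of the certified-decomposition machinery of
`ProbeRankThresholdFixedRankSaturationDecomp.lean`):

1. `pan_identity` — Pan's two-fold trilinear aggregation (Pan 1972; Pan 1984 §4,
   eqs. (4.1)–(4.3)): two disjoint `m × m × m` products in trace form cost `m³` aggregates
   `(c_{ik} + w_{ji})(a_{ij} + u_{jk})(b_{jk} + v_{ki})` plus `3m²` corrections; a finite-sum
   identity over `ℂ`.
2. `hasDecompPan` — the design on `⟨2m⟩` with block index type `Fin 2 × Fin m`: the `8` block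
   products are coupled in the `4` pairs `{(0,L,J), (1,L+1,J+1)}` (distinct blocks in every
   slot), each pair computed by `pan_identity`; `4m³ + 12m²` triads whose legs are sums of at
   most two rank-one segments (matrix units, row segments, column segments), i.e. carry
   certificates of size `2`.  Verified through `mmT_eq_of_forms` (identity of trilinear forms).
3. `HasDecomp.pow` + `HasDecomp.restrict`: the `k`-th Kronecker power is a scheme for
   `⟨(2m)^k⟩` with `(4m³+12m²)^k` terms and certificates `2^k`; for large `n` take the least `m`
   with `(2m)^k ≥ n` and restrict to `⟨n⟩`.
4. `eventually_pan_count_le` + `fixedRankSaturation_proof`: with `t = m - 1`, minimality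
   gives `(2t)^k < n`, and `2^k · (4m³+12m²)^k = 8^k ((t+1)³ + 3(t+1)²)^k ≤ (1+ε) 8^k t^{3k}
   = (1+ε) ((2t)^k)³ ≤ (1+ε) n³` for `t` large (`(t+1)³ + 3(t+1)² ≤ t³ (1 + 19/t)` and
   `(1 + 19/t)^k → 1`); `k = 0` is the standard algorithm (`n³` terms of probe rank `1`).
(The route's `PanAggregation`, item 6605, is `hasDecompPanFin` read through `HasDecomp.toFin`;
it was landed independently in `ProbeRankThresholdPanAggregation.lean`.)

References: V. Ya. Pan, *How to multiply matrices faster*, LNCS 179, Springer 1984, §4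
[Pan1984]; V. Ya. Pan, *Strassen's algorithm is not optimal*, FOCS 1978 [Pan1978]; M. Bläser,
*Fast Matrix Multiplication*, ToC Graduate Surveys 5 (2013) [Blaser2013].
-/

-- single-conjunct summit: the `Summit.<S>.<P>` prefix repeats `MatrixMultiplication` by design (D-0017)
set_option linter.dupNamespace false

noncomputable section

open scoped BigOperators
open Literature.Computability.AlgebraicComplexity

namespace Summit.MatrixMultiplication.MatrixMultiplication.Theorems

namespace FixedRankSaturation

/-! ### Pan's two-fold trilinear aggregation: the algebraic identity -/

/-- **Pan's aggregation identity for two disjoint products** (Pan 1972/1978; Pan 1984 §4,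
(4.1)–(4.3)).  For six `m × m` arrays — `a, b, c` the variables of one product in trace form
`∑ c_{ik} a_{ij} b_{jk}` and `u, v, w` those of a second, independent one — the sum of the two
trace forms equals `m³` AGGREGATES `(c_{ik} + w_{ji})(a_{ij} + u_{jk})(b_{jk} + v_{ki})` minus
`3m²` CORRECTION products, each correction being (one variable) · (one variable) · (a sum of a
row and a column).  The six cross terms of the aggregates are exactly cancelled. -/
theorem pan_identity (m : ℕ) (a u b v c w : Fin m → Fin m → ℂ) :
    ((∑ i, ∑ j, ∑ k, c i k * a i j * b j k) + ∑ i, ∑ j, ∑ k, w i k * u i j * v j k) =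
      (∑ i, ∑ j, ∑ k, (c i k + w j i) * (a i j + u j k) * (b j k + v k i)) +
      (∑ i, ∑ j, -w j i * a i j * ((∑ k, b j k) + ∑ k, v k i)) +
      (∑ i, ∑ k, -c i k * ((∑ j, a i j) + ∑ j, u j k) * v k i) +
      ∑ j, ∑ k, -((∑ i, c i k) + ∑ i, w j i) * u j k * b j k := by
  -- the six cross terms, each reduced to `m²` products with an inner row/column sum
  have R_cav : (∑ i, ∑ j, ∑ k, c i k * a i j * v k i) =
      ∑ i, ∑ k, (c i k * ∑ j, a i j) * v k i := by
    simp only [Finset.mul_sum, Finset.sum_mul]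
    exact Finset.sum_congr rfl fun _ _ => Finset.sum_comm
  have R_cuv : (∑ i, ∑ j, ∑ k, c i k * u j k * v k i) =
      ∑ i, ∑ k, (c i k * ∑ j, u j k) * v k i := by
    simp only [Finset.mul_sum, Finset.sum_mul]
    exact Finset.sum_congr rfl fun _ _ => Finset.sum_comm
  have R_cub : (∑ i, ∑ j, ∑ k, c i k * u j k * b j k) =
      ∑ j, ∑ k, (∑ i, c i k) * u j k * b j k := by
    simp only [Finset.sum_mul]
    rw [Finset.sum_comm]
    exact Finset.sum_congr rfl fun _ _ => Finset.sum_comm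
  have R_wub : (∑ i, ∑ j, ∑ k, w j i * u j k * b j k) =
      ∑ j, ∑ k, (∑ i, w j i) * u j k * b j k := by
    simp only [Finset.sum_mul]
    rw [Finset.sum_comm]
    exact Finset.sum_congr rfl fun _ _ => Finset.sum_comm
  have R_wab : (∑ i, ∑ j, ∑ k, w j i * a i j * b j k) =
      ∑ i, ∑ j, w j i * a i j * ∑ k, b j k := by
    simp only [Finset.mul_sum]
  have R_wav : (∑ i, ∑ j, ∑ k, w j i * a i j * v k i) =
      ∑ i, ∑ j, w j i * a i j * ∑ k, v k i := by
    simp only [Finset.mul_sum]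
  -- the second wanted product appears with its summation indices rotated
  have R_wuv : (∑ i, ∑ j, ∑ k, w j i * u j k * v k i) =
      ∑ i, ∑ j, ∑ k, w i k * u i j * v j k := by
    rw [Finset.sum_comm]
    exact Finset.sum_congr rfl fun _ _ => Finset.sum_comm
  simp only [add_mul, mul_add, neg_add, neg_mul, Finset.sum_add_distrib, Finset.sum_neg_distrib]
  rw [R_cav, R_cub, R_cuv, R_wab, R_wav, R_wub, R_wuv]
  ring

/-! ### Pan's design on `⟨2m⟩`: the two-fold aggregation, block-embedded -/

/-- **Pan's two-fold aggregation design for `⟨2m⟩`** (Pan 1984, §4; Kronsjö 1986,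
pp. 18–20).  On the block index type `Fin 2 × Fin m`, `⟨2m, 2m, 2m⟩` is the sum of
`4m³ + 12m²` triads every leg of which carries a low-rank certificate of size `2`.

Terms are indexed by aggregates `(L, J, i, j, k)` and three correction families `(L, J, ·, ·)`.
The block pair `(L, J)` couples the block product `(0, L, J)` — variables
`a_{ij} = x_{(0,i),(L,j)}`, `b_{jk} = y_{(L,j),(J,k)}`, `c_{ik} = z_{(0,i),(J,k)}` — with the
block product `(1, L+1, J+1)` — `u_{jk} = x_{(1,j),(L+1,k)}`, `v_{ki} = y_{(L+1,k),(J+1,i)}`,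
`w_{ji} = z_{(1,j),(J+1,i)}`; the two products occupy different blocks in each of the three
slots, so they are disjoint `⟨m⟩`'s and `pan_identity` applies.  Legs (slot A = `z`, B = `x`,
C = `y`): aggregate `(c_{ik} + w_{ji}) ⊗ (a_{ij} + u_{jk}) ⊗ (b_{jk} + v_{ki})`; corrections
`(-w_{ji}) ⊗ a_{ij} ⊗ (∑_k b_{jk} + ∑_k v_{ki})`, `(-c_{ik}) ⊗ (∑_j a_{ij} + ∑_j u_{jk}) ⊗ v_{ki}`,
`-(∑_i c_{ik} + ∑_i w_{ji}) ⊗ u_{jk} ⊗ b_{jk}` — each leg a sum of at most two rank-one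
segments (matrix units `unitLeg`, row segments `rowLeg`, column segments `colLeg`).  The tensor
identity is checked on trilinear forms (`mmT_eq_of_forms`): both sides reduce to the four
instances `(L, J) ∈ (Fin 2)²` of `pan_identity`. -/
theorem hasDecompPan (m : ℕ) :
    HasDecomp (Fin 2 × Fin m) ((Fin 2 × Fin 2 × Fin m × Fin m × Fin m) ⊕
      (Fin 2 × Fin 2 × Fin m × Fin m) ⊕ (Fin 2 × Fin 2 × Fin m × Fin m) ⊕
      (Fin 2 × Fin 2 × Fin m × Fin m)) 2 := by
  refine ⟨-- slot A (`z`, product entries); `s = (L, J, i, j, k)` resp. `(L, J, ·, ·)`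
    Sum.elim (fun s => unitLeg (0, s.2.2.1) (s.2.1, s.2.2.2.2) +
        unitLeg (1, s.2.2.2.1) (s.2.1 + 1, s.2.2.1))
      (Sum.elim (fun s => -unitLeg (1, s.2.2.2) (s.2.1 + 1, s.2.2.1))
      (Sum.elim (fun s => -unitLeg (0, s.2.2.1) (s.2.1, s.2.2.2))
        (fun s => -(colLeg 0 (s.2.1, s.2.2.2) + rowLeg (1, s.2.2.1) (s.2.1 + 1))))),
    -- slot B (`x`, left factor)
    Sum.elim (fun s => unitLeg (0, s.2.2.1) (s.1, s.2.2.2.1) +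
        unitLeg (1, s.2.2.2.1) (s.1 + 1, s.2.2.2.2))
      (Sum.elim (fun s => unitLeg (0, s.2.2.1) (s.1, s.2.2.2))
      (Sum.elim (fun s => rowLeg (0, s.2.2.1) s.1 + colLeg 1 (s.1 + 1, s.2.2.2))
        (fun s => unitLeg (1, s.2.2.1) (s.1 + 1, s.2.2.2)))),
    -- slot C (`y`, right factor)
    Sum.elim (fun s => unitLeg (s.1, s.2.2.2.1) (s.2.1, s.2.2.2.2) +
        unitLeg (s.1 + 1, s.2.2.2.2) (s.2.1 + 1, s.2.2.1))
      (Sum.elim (fun s => rowLeg (s.1, s.2.2.2) s.2.1 + colLeg (s.1 + 1) (s.2.1 + 1, s.2.2.1))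
      (Sum.elim (fun s => unitLeg (s.1 + 1, s.2.2.2) (s.2.1 + 1, s.2.2.1))
        (fun s => unitLeg (s.1, s.2.2.1) (s.2.1, s.2.2.2)))),
    ?_, ?_⟩
  · refine mmT_eq_of_forms _ _ _ fun z x y => ?_
    have h11 : (1 : Fin 2) + 1 = 0 := by decide
    -- the four instances of Pan's identity, one per block pair `(L, J)`
    have P00 := pan_identity m (fun i j => x ((0, i), (0, j))) (fun j k => x ((1, j), (1, k)))
      (fun j k => y ((0, j), (0, k))) (fun k i => y ((1, k), (1, i)))
      (fun i k => z ((0, i), (0, k))) (fun j i => z ((1, j), (1, i)))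
    have P01 := pan_identity m (fun i j => x ((0, i), (0, j))) (fun j k => x ((1, j), (1, k)))
      (fun j k => y ((0, j), (1, k))) (fun k i => y ((1, k), (0, i)))
      (fun i k => z ((0, i), (1, k))) (fun j i => z ((1, j), (0, i)))
    have P10 := pan_identity m (fun i j => x ((0, i), (1, j))) (fun j k => x ((1, j), (0, k)))
      (fun j k => y ((1, j), (0, k))) (fun k i => y ((0, k), (1, i)))
      (fun i k => z ((0, i), (0, k))) (fun j i => z ((1, j), (1, i)))
    have P11 := pan_identity m (fun i j => x ((0, i), (1, j))) (fun j k => x ((1, j), (0, k)))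
      (fun j k => y ((1, j), (1, k))) (fun k i => y ((0, k), (0, i)))
      (fun i k => z ((0, i), (1, k))) (fun j i => z ((1, j), (0, i)))
    simp only [Fintype.sum_sum_type, Sum.elim_inl, Sum.elim_inr]
    simp only [Pi.add_apply, Pi.neg_apply, add_mul, neg_mul, neg_add, Finset.sum_add_distrib,
      Finset.sum_neg_distrib, pair_unitLeg, pair_rowLeg, pair_colLeg]
    simp only [Fintype.sum_prod_type, Fin.sum_univ_two, zero_add, h11, Fin.isValue, add_mul,
      mul_add, neg_mul, neg_add, Finset.sum_add_distrib, Finset.sum_neg_distrib]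
      at P00 P01 P10 P11 ⊢
    linear_combination P00 + P01 + P10 + P11
  · rintro (s | s | s | s) <;> simp only [Sum.elim_inl, Sum.elim_inr]
    · exact ⟨(isLowRank_unitLeg _ _).add (isLowRank_unitLeg _ _),
        (isLowRank_unitLeg _ _).add (isLowRank_unitLeg _ _),
        (isLowRank_unitLeg _ _).add (isLowRank_unitLeg _ _)⟩
    · exact ⟨(isLowRank_unitLeg _ _).neg.mono one_le_two,
        (isLowRank_unitLeg _ _).mono one_le_two,
        (isLowRank_rowLeg _ _).add (isLowRank_colLeg _ _)⟩
    · exact ⟨(isLowRank_unitLeg _ _).neg.mono one_le_two,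
        (isLowRank_rowLeg _ _).add (isLowRank_colLeg _ _),
        (isLowRank_unitLeg _ _).mono one_le_two⟩
    · exact ⟨((isLowRank_colLeg _ _).add (isLowRank_rowLeg _ _)).neg,
        (isLowRank_unitLeg _ _).mono one_le_two, (isLowRank_unitLeg _ _).mono one_le_two⟩

/-- **Pan's design transported to `⟨2m⟩ = ⟨Fin (2m)⟩`** (the route's `PanAggregation` in
certified form): `4m³ + 12m²` terms, certificates of size `2`. -/
theorem hasDecompPanFin (m : ℕ) : HasDecomp (Fin (2 * m)) (Fin (4 * m ^ 3 + 12 * m ^ 2)) 2 :=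
  ((hasDecompPan m).comap finProdFinEquiv.symm finProdFinEquiv.symm.injective).reindex
    (Fintype.equivFinOfCardEq (by
      simp only [Fintype.card_sum, Fintype.card_prod, Fintype.card_fin]
      ring))

/-! ### The analytic bookkeeping and the route statement -/

/-- The analytic heart of the count: `((t+1)³ + 3(t+1)²)^k ≤ (1+ε) t^{3k}` for all large `t`
(the `3m²` correction terms and the rounding `m ↦ m - 1` cost a factor `(1 + O(1/t))^k → 1`). -/
theorem eventually_pan_count_le (k : ℕ) {ε : ℝ} (hε : 0 < ε) :
    ∀ᶠ t : ℕ in Filter.atTop,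
      ((t + 1 : ℝ) ^ 3 + 3 * (t + 1) ^ 2) ^ k ≤ (1 + ε) * ((t : ℝ) ^ 3) ^ k := by
  have h : Filter.Tendsto (fun t : ℕ => (1 + 19 / (t : ℝ)) ^ k) Filter.atTop (nhds 1) := by
    have := ((tendsto_const_div_atTop_nhds_zero_nat (19 : ℝ)).const_add 1).pow k
    simpa using this
  filter_upwards [(tendsto_order.1 h).2 (1 + ε) (by linarith), Filter.eventually_ge_atTop 1]
    with t ht ht1
  have ht0 : (1 : ℝ) ≤ t := by exact_mod_cast ht1
  have hpoly : (t + 1 : ℝ) ^ 3 + 3 * (t + 1) ^ 2 ≤ (t : ℝ) ^ 3 * (1 + 19 / t) := by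
    have hrw : (t : ℝ) ^ 3 * (1 + 19 / t) = (t : ℝ) ^ 3 + 19 * (t : ℝ) ^ 2 := by
      field_simp
    rw [hrw]
    nlinarith [ht0, sq_nonneg (t : ℝ)]
  calc ((t + 1 : ℝ) ^ 3 + 3 * (t + 1) ^ 2) ^ k
      ≤ ((t : ℝ) ^ 3 * (1 + 19 / t)) ^ k := pow_le_pow_left₀ (by positivity) hpoly k
    _ = ((t : ℝ) ^ 3) ^ k * (1 + 19 / (t : ℝ)) ^ k := mul_pow _ _ _
    _ ≤ ((t : ℝ) ^ 3) ^ k * (1 + ε) := mul_le_mul_of_nonneg_left ht.le (by positivity)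
    _ = (1 + ε) * ((t : ℝ) ^ 3) ^ k := mul_comm _ _

end FixedRankSaturation

open FixedRankSaturation in
/-- **Fixed-entanglement saturation** (route ProbeRankThreshold, item `FixedRankSaturation`,
stmt-MatrixMultiplication-6606): for every `k` and `ε > 0`, for all large `n`, `⟨n,n,n⟩` has a
decomposition into at most `(1+ε) n³ / 2^k` triads all of whose probes (legs read as `n × n`
matrices) have rank `≤ 2^k`.  Proof: the `k`-th Kronecker power of Pan's two-fold aggregation
design (`⟨2m⟩` in `4m³ + 12m²` triads with probe-rank certificates `2`, `hasDecompPanFin`) is a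
scheme for `⟨(2m)^k⟩` with `(4m³+12m²)^k` terms and certificates `2^k` (`HasDecomp.pow`); for a
large `n` take the least `m` with `(2m)^k ≥ n` and restrict (`HasDecomp.restrict`); since
`(2(m-1))^k < n`, the count is `≤ (1+ε) n³/2^k` by `eventually_pan_count_le`.  For `k = 0` the
standard algorithm (`hasDecompTrivial`) has `n³` terms of probe rank `≤ 1`. -/
theorem fixedRankSaturation_proof :
    Summit.MatrixMultiplication.MatrixMultiplication.Theses.ProbeRankThreshold.FixedRankSaturation := by
  unfold Summit.MatrixMultiplication.MatrixMultiplication.Theses.ProbeRankThreshold.FixedRankSaturation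
  intro k ε hε
  rcases Nat.eq_zero_or_pos k with rfl | hk
  · -- `k = 0`: the standard algorithm, `n³` terms, probe ranks `≤ 1`
    refine Filter.Eventually.of_forall fun n => ?_
    have hD : HasDecomp (Fin n) (Fin (n * (n * n))) 1 :=
      (hasDecompTrivial (Fin n)).reindex
        (((Equiv.refl (Fin n)).prodCongr finProdFinEquiv).trans finProdFinEquiv)
    obtain ⟨w, u, v, he, hr⟩ := hD.restrict le_rfl
    refine ⟨n * (n * n), w, u, v, ?_, he, by simpa using hr⟩
    have hn : (0 : ℝ) ≤ (n : ℝ) ^ 3 := by positivity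
    have h1 : ((n * (n * n) : ℕ) : ℝ) = (n : ℝ) ^ 3 := by push_cast; ring
    rw [h1, pow_zero, div_one]
    nlinarith
  · -- `k ≥ 1`: Kronecker powers of Pan's design
    obtain ⟨t₀, ht₀⟩ := Filter.eventually_atTop.1 (eventually_pan_count_le k hε)
    refine Filter.eventually_atTop.2 ⟨(2 * (t₀ + 1)) ^ k + 1, fun n hn => ?_⟩
    have hk0 : k ≠ 0 := Nat.pos_iff_ne_zero.1 hk
    -- the least `m` with `n ≤ (2m)^k`
    have hex : ∃ m : ℕ, n ≤ (2 * m) ^ k :=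
      ⟨n, (Nat.le_self_pow hk0 n).trans (Nat.pow_le_pow_left (by omega) k)⟩
    classical
    obtain ⟨m, hm, hmin⟩ : ∃ m : ℕ, n ≤ (2 * m) ^ k ∧ ∀ m', n ≤ (2 * m') ^ k → m ≤ m' :=
      ⟨Nat.find hex, Nat.find_spec hex, fun m' h => Nat.find_min' hex h⟩
    have hmt : t₀ + 1 < m := by
      by_contra hle
      push Not at hle
      have : (2 * m) ^ k ≤ (2 * (t₀ + 1)) ^ k := Nat.pow_le_pow_left (by omega) k
      omega
    obtain ⟨t, rfl⟩ : ∃ t, m = t + 1 := ⟨m - 1, by omega⟩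
    have ht : t₀ ≤ t := by omega
    have hlt : (2 * t) ^ k < n := by
      by_contra hge
      push Not at hge
      have := hmin t hge
      omega
    -- the scheme: `k`-th Kronecker power of Pan's design on `⟨2(t+1)⟩`, restricted to `⟨n⟩`
    obtain ⟨w, u, v, he, hr⟩ := ((hasDecompPanFin (t + 1)).pow k).restrict hm
    refine ⟨_, w, u, v, ?_, he, hr⟩
    -- the count
    have hcount := ht₀ t ht
    have hn3 : (((2 * t) ^ k : ℕ) : ℝ) ^ 3 ≤ (n : ℝ) ^ 3 :=
      pow_le_pow_left₀ (by positivity) (by exact_mod_cast hlt.le) 3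
    have h2k : (0 : ℝ) < 2 ^ k := by positivity
    rw [le_div_iff₀ h2k]
    calc (((4 * (t + 1) ^ 3 + 12 * (t + 1) ^ 2) ^ k : ℕ) : ℝ) * 2 ^ k
        = (8 * ((t + 1 : ℝ) ^ 3 + 3 * (t + 1) ^ 2)) ^ k := by
          push_cast
          rw [← mul_pow]
          ring
      _ = 8 ^ k * ((t + 1 : ℝ) ^ 3 + 3 * (t + 1) ^ 2) ^ k := mul_pow _ _ _
      _ ≤ 8 ^ k * ((1 + ε) * ((t : ℝ) ^ 3) ^ k) :=
          mul_le_mul_of_nonneg_left hcount (by positivity)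
      _ = (1 + ε) * (((2 * t : ℝ) ^ 3) ^ k) := by
          rw [mul_pow, mul_pow]
          ring
      _ = (1 + ε) * (((2 * t) ^ k : ℕ) : ℝ) ^ 3 := by
          push_cast
          rw [← pow_mul, ← pow_mul, mul_comm 3 k]
      _ ≤ (1 + ε) * (n : ℝ) ^ 3 := mul_le_mul_of_nonneg_left hn3 (by positivity)

end Summit.MatrixMultiplication.MatrixMultiplication.Theorems

end
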